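import Summits.AtomisticToContinuum.FouriersLaw.Theses.EmbeddedDrudeMourre
import Literature.MathematicalPhysics.KineticTheory.HarmonicChaosDecomposition
import Literature.MathematicalPhysics.KineticTheory.ZeroWavenumberSpace
import Literature.MathematicalPhysics.KineticTheory.InfiniteChainInvariantStates
import Literature.MathematicalPhysics.KineticTheory.InfiniteChainSuperstableDynamics
import Summits.AtomisticToContinuum.FouriersLaw.Theorems.EmbeddedDrudeMourreDrudeDissolutionStubForceWindowChaosSpectral
import Summits.AtomisticToContinuum.FouriersLaw.Theorems.EmbeddedDrudeMourreDrudeDissolutionStubForceWindowPairSector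
import Summits.AtomisticToContinuum.FouriersLaw.Theorems.EmbeddedDrudeMourreDrudeDissolutionStubFreeForceKernelSectorGap
import HarnessLib

/-!
# Stub KT `stub_forceWindow`: the explicit spectral measure of a quartic Wick vector and its window density
(stub `stub_forceWindow` of line `gram-pencil-harmonic-chaos`, crux `EmbeddedDrudeMourre.DrudeDissolution`,
item stmt-AtomisticToContinuum-12593; `--supports` file, closes nothing)

WHAT. The registered stub KT of the checked skeleton (lead c11, v5): for couplings `a, b > 0` with the
odd-sector gap of ALS's linearised phonon Boltzmann form and ANY finite family `(c_j, f_j)` of quartic Wick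
monomial data whose symmetrised pair kernel `Σ_j c_j · wickKernel ω₂ 1 (f j) 2 2` obeys clause (β) of stub KΦ
(distance to the rigid model `A i [sin] Φ/∏ω`, `A ≠ 0`, controlled by the free frequency), the vector
`Ψ₄ = Σ_j c_j • wickVector ω₂ 1 (f j)` of the zero-wavenumber chaos space has under the free Koopman group a
spectral measure `m` — `Re⟪Ψ₄, U⁰_t Ψ₄⟫ = ∫ cos(xt) dm(x)` — which is finite and has on a window `(−δ, δ)` a
continuous density `ρ ≥ 0` with `ρ(0) > 0`.

HOW. `m := Σ_{s : cr + an = 4} (Ω_s)_*(‖Ψ₄ s‖² σ_s)` (part 0, `re_inner_chaosKoopman_eq_integral_cos`: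
`Ψ₄` vanishes off the degree-`4` sectors, `sum_smul_wickVector_eq_zero_of_ne`). WINDOW: for
`δ ≤ c(ω₂) = 8ω₂/(√(9ω₂+36) + √(ω₂+36))` the far sectors `(4,0), (3,1), (1,3), (0,4)` carry no mass on
`(−δ, δ)` (landed `restrict_window_sectorSum_eq_pair`, `sectorPhase_far_gap`), so `m` restricts to the
pair-sector push-forward `(Ω₂₂)_*(‖Ψ₄ (2,2)‖² σ₂₂)` alone; its weight is a.e. `|Σ_j c_j wickKernel (f j) 2 2|²`
(`withDensity_sum_smul_wickVector`), a continuous kernel satisfying (β), and part IV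
(`forceWindow_pairSector_of`: transport to the real cell, generalised threshold continuity on top of the
landed slab estimate of the sibling crux stmt-AtomisticToContinuum-12594, positivity at `0` from the golden
rule for `sin` and `HasOddSectorGap`) gives the continuous density, positive at `0`; the window is shrunk to
`min(δ₂₂, c(ω₂))`. [cite: AokiLukkarinenSpohn2006, eqs. (3.17)–(3.20), (4.1), (4.10)–(4.11), (4.16)]
-/

noncomputable section

namespace Summit.AtomisticToContinuum.FouriersLaw.Theorems.DrudeDissolution.GramPencilHarmonicChaos

open MeasureTheory Filter Set Function Topology
open scoped InnerProductSpace ENNReal ComplexConjugate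
open Literature.MathematicalPhysics.KineticTheory
open Literature.MathematicalPhysics.KineticTheory.HeatConduction
open Literature.MathematicalPhysics.KineticTheory.PhononBoltzmann
open HarmonicChaos ProbabilityTheory
open PinnedChainKinetic (𝕋 𝕋3 μ𝕋 μ𝕋3 k₄ sinT)
open scoped Literature.MathematicalPhysics.KineticTheory.HeatConduction.PinnedChainKinetic

/-! ### Shrinking a window -/

/-- A window density survives shrinking the window. [folklore] -/
theorem forceWindow_window_mono {m : Measure ℝ} {δ δ' : ℝ} {g : ℝ → ℝ≥0∞} (hδ : δ' ≤ δ)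
    (h : m.restrict (Set.Ioo (-δ) δ) = (volume.restrict (Set.Ioo (-δ) δ)).withDensity g) :
    m.restrict (Set.Ioo (-δ') δ') = (volume.restrict (Set.Ioo (-δ') δ')).withDensity g := by
  have hsub : Set.Ioo (-δ') δ' ⊆ Set.Ioo (-δ) δ := Set.Ioo_subset_Ioo (by linarith) hδ
  have hI : Set.Ioo (-δ') δ' ∩ Set.Ioo (-δ) δ = Set.Ioo (-δ') δ' := Set.inter_eq_left.2 hsub
  have h' := congrArg (fun μ : Measure ℝ => μ.restrict (Set.Ioo (-δ') δ')) h
  rwa [Measure.restrict_restrict measurableSet_Ioo, restrict_withDensity measurableSet_Ioo,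
    Measure.restrict_restrict measurableSet_Ioo, hI] at h'

/-! ### The degree-four sectors -/

/-- The finite set of sector labels `(m, n)` with `m + n = 4`. [folklore] -/
theorem forceWindow_mem_sectorsFour (s : SectorIndex) :
    s ∈ (finite_sectorIndex_sum 4).toFinset ↔ s.cr + s.an = 4 :=
  Set.Finite.mem_toFinset _

/-- The pair label `(2,2)` has degree four, and a degree-four label is not the one-phonon-charge label
`(1,1)`. [folklore] -/
theorem forceWindow_sectorsFour_basic :
    (⟨(2, 2), by simp⟩ : SectorIndex) ∈ (finite_sectorIndex_sum 4).toFinset ∧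
      ∀ s ∈ (finite_sectorIndex_sum 4).toFinset, s.1 ≠ (1, 1) := by
  refine ⟨(forceWindow_mem_sectorsFour _).2 rfl, fun s hs h11 => ?_⟩
  have h4 := (forceWindow_mem_sectorsFour s).1 hs
  have h1 : s.cr = 1 := congrArg Prod.fst h11
  have h2 : s.an = 1 := congrArg Prod.snd h11
  omega

/-! ### The registered stub -/

/-- **STUB KT of line `gram-pencil-harmonic-chaos` (`stub_forceWindow`): the explicit spectral measure of a
quartic Wick vector under the free Koopman group, and its window density, positive at the threshold.**
For `ω₂, a, b > 0` with the odd-sector gap of the linearised phonon Boltzmann form and any finite family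
`(c_j, f_j)` of quartic Wick data whose symmetrised pair kernel obeys the rigid-model bound (β) of stub KΦ,
the vector `Ψ₄ = Σ_j c_j • wickVector ω₂ 1 (f j)` has a finite spectral measure `m`,
`∫ cos(xt) dm = Re⟪Ψ₄, U⁰_t Ψ₄⟫`, with a continuous density `ρ ≥ 0`, `ρ(0) > 0`, on a window `(−δ, δ)`:
the sector sum `Σ_{cr+an=4} (Ω_s)_*(‖Ψ₄ s‖²σ_s)`, whose far sectors are gapped and whose pair sector is the
two-phonon density of states at the threshold (Aoki–Lukkarinen–Spohn's golden-rule/Boltzmann dictionary).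
[cite: AokiLukkarinenSpohn2006, eqs. (3.17)–(3.20), (4.1), (4.10)–(4.11), (4.16)] -/
theorem stub_forceWindow :
    ∀ ω₂ a b : ℝ, 0 < ω₂ → 0 < a → 0 < b → HasOddSectorGap ω₂ a b →
    ∀ (J : ℕ) (c : Fin J → ℝ) (f : Fin J → Fin 4 → TestFn),
      (∃ A : ℝ, A ≠ 0 ∧ ∃ C : ℝ, ∀ κ : Shell 2 2,
          ‖(∑ j : Fin J, (c j : ℂ) * wickKernel ω₂ 1 (f j) 2 2 κ) -
              (A : ℂ) * Complex.I *
                ((sinT ((κ : SectorConfig 2 2).1 0) + sinT ((κ : SectorConfig 2 2).1 1) - sinT ((κ : SectorConfig 2 2).2 0) - sinT ((κ : SectorConfig 2 2).2 1) : ℝ) : ℂ) *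
                (PinnedChainKinetic.vertex a b ((κ : SectorConfig 2 2).1 0, (κ : SectorConfig 2 2).1 1, (κ : SectorConfig 2 2).2 0) : ℂ) /
                ((PinnedChainKinetic.dispersion ω₂ ((κ : SectorConfig 2 2).1 0) * PinnedChainKinetic.dispersion ω₂ ((κ : SectorConfig 2 2).1 1) * PinnedChainKinetic.dispersion ω₂ ((κ : SectorConfig 2 2).2 0) * PinnedChainKinetic.dispersion ω₂ ((κ : SectorConfig 2 2).2 1) : ℝ) : ℂ)‖ ≤
            C * |sectorPhase ω₂ κ|) →
      ∃ m : MeasureTheory.Measure ℝ, MeasureTheory.IsFiniteMeasure m ∧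
        (∀ t : ℝ, ∫ x, Real.cos (x * t) ∂m =
          (⟪(∑ j : Fin J, (c j : ℂ) • wickVector ω₂ 1 (f j)), chaosKoopman ω₂ t (∑ j : Fin J, (c j : ℂ) • wickVector ω₂ 1 (f j))⟫_ℂ).re) ∧
        ∃ δ : ℝ, 0 < δ ∧ ∃ ρ : ℝ → ℝ, ContinuousOn ρ (Set.Ioo (-δ) δ) ∧ (∀ x ∈ Set.Ioo (-δ) δ, 0 ≤ ρ x) ∧ 0 < ρ 0 ∧
          m.restrict (Set.Ioo (-δ) δ) = (volume.restrict (Set.Ioo (-δ) δ)).withDensity (fun x => ENNReal.ofReal (ρ x)) := by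
  intro ω₂ a b hω _ _ hgap J c f hpair
  obtain ⟨A, hA, C, hβ⟩ := hpair
  -- the finitely many sectors of degree four and the vanishing of `Ψ₄` elsewhere
  have hΨ0 : ∀ s ∉ (finite_sectorIndex_sum 4).toFinset,
      (∑ j : Fin J, (c j : ℂ) • wickVector ω₂ 1 (f j) : ChaosSpace) s = 0 := fun s hs =>
    sum_smul_wickVector_eq_zero_of_ne ω₂ 1 (fun j => (c j : ℂ)) f (fun h => hs ((forceWindow_mem_sectorsFour s).2 h))
  -- the spectral measure
  refine ⟨∑ s ∈ (finite_sectorIndex_sum 4).toFinset,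
      ((shellMeasure s.cr s.an).withDensity (fun κ => ENNReal.ofReal
        (‖(∑ j : Fin J, (c j : ℂ) • wickVector ω₂ 1 (f j) : ChaosSpace) s κ‖ ^ 2))).map (sectorPhase ω₂),
    isFiniteMeasure_sectorSum ω₂ _ _, fun t => ?_, ?_⟩
  · exact (re_inner_chaosKoopman_eq_integral_cos ω₂ _ _ hΨ0 t).symm
  · -- the pair sector
    have hG : Continuous fun κ : Shell 2 2 => ∑ j : Fin J, (c j : ℂ) * wickKernel ω₂ 1 (f j) 2 2 κ :=
      continuous_finsetSum _ fun j _ => continuous_const.mul (continuous_wickKernel hω 1 (f j) 2 2)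
    obtain ⟨δ₁, hδ₁, ρ, hρc, hρ0, hpos, hwin⟩ := forceWindow_pairSector_of hω hgap hG hA hβ
    -- the window below the far-sector gap
    have hc := three_one_gap_const_pos hω
    refine ⟨min δ₁ (8 * ω₂ / (Real.sqrt (9 * ω₂ + 36) + Real.sqrt (ω₂ + 36))), lt_min hδ₁ hc, ρ,
      hρc.mono (Set.Ioo_subset_Ioo (neg_le_neg (min_le_left _ _)) (min_le_left _ _)),
      fun x hx => hρ0 x (Set.Ioo_subset_Ioo (neg_le_neg (min_le_left _ _)) (min_le_left _ _) hx), hpos, ?_⟩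
    obtain ⟨h22, hne11⟩ := forceWindow_sectorsFour_basic
    have key := restrict_window_sectorSum_eq_pair hω (finite_sectorIndex_sum 4).toFinset
      (fun s => (shellMeasure s.cr s.an).withDensity (fun κ => ENNReal.ofReal
        (‖(∑ j : Fin J, (c j : ℂ) • wickVector ω₂ 1 (f j) : ChaosSpace) s κ‖ ^ 2)))
      (fun s hs => Or.inr ((forceWindow_mem_sectorsFour s).1 hs)) (fun s hs h11 => absurd h11 (hne11 s hs))
      (min_le_right δ₁ _)
    rw [if_pos h22] at key
    refine key.trans ?_
    have hν : (shellMeasure 2 2).withDensity (fun κ => ENNReal.ofReal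
        (‖(∑ j : Fin J, (c j : ℂ) • wickVector ω₂ 1 (f j) : ChaosSpace) ⟨(2, 2), by simp⟩ κ‖ ^ 2)) =
        (shellMeasure 2 2).withDensity (fun κ => ENNReal.ofReal
          (‖∑ j : Fin J, (c j : ℂ) * wickKernel ω₂ 1 (f j) 2 2 κ‖ ^ 2)) :=
      withDensity_sum_smul_wickVector hω 1 (fun j => (c j : ℂ)) f ⟨(2, 2), by simp⟩
    have hwin' := forceWindow_window_mono (min_le_left δ₁ (8 * ω₂ / (Real.sqrt (9 * ω₂ + 36) + Real.sqrt (ω₂ + 36)))) hwin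
    rw [← hν] at hwin'
    exact hwin'


end Summit.AtomisticToContinuum.FouriersLaw.Theorems.DrudeDissolution.GramPencilHarmonicChaos

end
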